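import Mathlib

/-!
# T5IsotypicCopy — the algebraic core of N1 §ID-3(d) (pub-hodge-repro2, seat p2, kernel annex)

Prose step (route/T5-ID-p2.md v7.1, ID-3(d)): the global theta lift `N := Θ^V_{(μ,ν),W}(π_W)`
is a closed subrepresentation of `L²_disc(G)`, which is a Hilbert direct sum of irreducible
subrepresentations with finite multiplicities (Liu §B.1; Borel–Wallach (2.7)); every irreducible
subrepresentation of `N` is isomorphic to ONE representation `π` (Liu p. 49 ll. 24–28 + Case 1
p. 48 ll. 52–55: finite and archimedean components pinned by the triple), and `m_disc(π) = 1`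
(p. 49 ll. 22–24). Conclusion: `N = π`, the single `π`-isotypic copy, so `N` is irreducible.

Algebraic shadow formalised here, on the module of `K_∞`-finite vectors over an abstract ring `R`
(the `(𝔤, K_∞) × G(𝔸_f)`-action): `M` a semisimple `R`-module, `N ≤ M` a non-zero submodule all
of whose simple submodules are isomorphic to a simple submodule `P` (Mathlib's
`IsIsotypicOfType R N P`), and `P`'s isotypic component in `M` is `P` itself (multiplicity one).
Then `N = P`, and `N` is simple. Mathlib's `le_isotypicComponent_iff` does the work.
-/

namespace Summit.Ventures.HodgeRepro2.T5IsotypicCopy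

variable {R M : Type*} [Ring R] [AddCommGroup M] [Module R M]

/-- Multiplicity one, in the form «every submodule of `M` isomorphic to `P` IS `P`», gives
that the `P`-isotypic component of `M` (the sum of all submodules isomorphic to `P`) is `P`. -/
theorem isotypicComponent_eq_self_of_unique (P : Submodule R M)
    (h : ∀ Q : Submodule R M, Nonempty (Q ≃ₗ[R] P) → Q = P) :
    isotypicComponent R M P = P := by
  unfold isotypicComponent
  apply le_antisymm
  · exact sSup_le fun Q hQ => (h Q hQ).le
  · exact le_sSup ⟨LinearEquiv.refl R P⟩

/-- ID-3(d): in a semisimple module `M`, a non-zero submodule `N` whose simple submodules are all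
isomorphic to the simple submodule `P`, with `P` of multiplicity one in `M` (its isotypic
component is `P`), is equal to `P`. -/
theorem eq_of_isIsotypicOfType_of_isotypicComponent_eq [IsSemisimpleModule R M]
    (N P : Submodule R M) [IsSimpleModule R P] (hN : N ≠ ⊥)
    (hiso : IsIsotypicOfType R N P) (hmult : isotypicComponent R M P = P) : N = P := by
  have h1 : N ≤ isotypicComponent R M P := le_isotypicComponent_iff.mpr hiso
  rw [hmult] at h1
  exact ((isSimpleModule_iff_isAtom.mp ‹IsSimpleModule R P›).le_iff_eq hN).mp h1

/-- ID-3(d), multiplicity one in the «unique copy» form: `N = P`. -/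
theorem eq_of_isIsotypicOfType_of_unique [IsSemisimpleModule R M]
    (N P : Submodule R M) [IsSimpleModule R P] (hN : N ≠ ⊥)
    (hiso : IsIsotypicOfType R N P)
    (h : ∀ Q : Submodule R M, Nonempty (Q ≃ₗ[R] P) → Q = P) : N = P :=
  eq_of_isIsotypicOfType_of_isotypicComponent_eq N P hN hiso
    (isotypicComponent_eq_self_of_unique P h)

/-- ID-3(d), conclusion «`Θ^V(π_W)` is irreducible»: under the same hypotheses `N` is simple. -/
theorem isSimpleModule_of_isIsotypicOfType_of_isotypicComponent_eq
    [IsSemisimpleModule R M] (N P : Submodule R M) [IsSimpleModule R P] (hN : N ≠ ⊥)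
    (hiso : IsIsotypicOfType R N P) (hmult : isotypicComponent R M P = P) :
    IsSimpleModule R N := by
  have hNP : N = P :=
    eq_of_isIsotypicOfType_of_isotypicComponent_eq N P hN hiso hmult
  subst hNP
  infer_instance

/-- The hypothesis `IsIsotypicOfType R N P` is implied by the stronger «every simple submodule of
`N` (as a submodule of `M`) equals `P`» — the form in which the prose states it (all irreducible
subrepresentations of the lift are one and the same subspace). -/
theorem isIsotypicOfType_of_forall_eq (N P : Submodule R M)
    (h : ∀ S : Submodule R M, IsSimpleModule R S → S ≤ N → S = P) :
    IsIsotypicOfType R N P := by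
  rw [isIsotypicOfType_submodule_iff]
  intro S hle hS
  obtain rfl := h S hS hle
  exact ⟨LinearEquiv.refl R S⟩

/-- Conversely, in the semisimple case, a non-zero `N` with all simple submodules equal to `P`
(as submodules of `M`) is `P` — no multiplicity hypothesis is needed in this form. -/
theorem eq_of_forall_simple_eq [IsSemisimpleModule R M]
    (N P : Submodule R M) (hN : N ≠ ⊥)
    (h : ∀ S : Submodule R M, IsSimpleModule R S → S ≤ N → S = P) : N = P := by
  obtain ⟨S, hSN, hS⟩ := (IsSemisimpleModule.eq_bot_or_exists_simple_le N).resolve_left hN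
  have hPN : P ≤ N := (h S hS hSN) ▸ hSN
  refine le_antisymm ?_ hPN
  calc N = sSup {m : Submodule R M | IsSimpleModule R m ∧ m ≤ N} :=
        (IsSemisimpleModule.sSup_simples_le N).symm
    _ ≤ P := sSup_le fun m ⟨hm, hmN⟩ => (h m hm hmN).le

end Summit.Ventures.HodgeRepro2.T5IsotypicCopy
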